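import Summits.AnomalousDissipation.AnomalousDissipation.Theorems.SolenoidalFractalHomogenisationLagrangianStepTransverseSymbolPolynomial
import Mathlib.Analysis.Calculus.Deriv.Polynomial
import Mathlib.Analysis.Calculus.Deriv.Shift
import Mathlib.Analysis.Calculus.Deriv.Pow
import Mathlib.Analysis.Calculus.Deriv.Inv
import Mathlib.Analysis.Calculus.MeanValue
import HarnessLib

/-!
# K1L_D `LagrangianRenormalisationStepDesign` (stmt-AnomalousDissipation-27980), `stub_D1_V0` (V0 = clause (ii) of
# `WCrossing.D1ExactFamily`): DIRECTION-LIPSCHITZ CONTINUITY OF THE LERAY-PROJECTED SYMBOL FROM TRANSVERSE DATA ONLY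
# (helper; `--kind proof --supports stmt-AnomalousDissipation-27980 --as helper`)

Summits-side helper file of route `SolenoidalFractalHomogenisation` (prover seat `ad-k1l-cellLawV-w1` g6; FINDING F-w1g6-1 on the
cell STATUS board 2026-08-29T01:48Z), part 2 of 2 (part 1: `…TransverseSymbolPolynomial`).  Everything proved; no named facts, no sorry.

CONTENT.  From part 1 (`|N'(0)|·|k| ≤ 352·K₀·|k|⁶|δ||p||q|`, node bound `|N(0)| ≤ K₀|k|⁶|p||q|`, `|(|k|²)'| ≤ 2|k||δ|`):
§4 the derivative of the ratio `s ↦ N(s)/|k_s|⁴ = β_𝔸(k_s; π_{k_s}p, π_{k_s}q)` at a base point, `|D| ≤ 356·K₀·|k||δ||p||q|`;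
§5 **`abs_bsymb_lerayR_sub_le`**: for `|δ| ≤ |k|/2` and ALL real `p, q`,
`|β_𝔸(k+δ; π_{k+δ}p, π_{k+δ}q) − β_𝔸(k; π_k p, π_k q)| ≤ 534·K₀·|k|·|δ|·|p|·|q|` (re-base at every `k_s`, mean value inequality on
`[0,1]`), where `K₀` is ANY bound of the bilinear symbol on TRANSVERSE pairs (`K₀ = hi + β/2` from `NearIso 𝔸 lo hi`, `0 ≤ lo`,
`OddSmall 𝔸 β`: `…ThreeMode.abs_bsymb_le`) — an ABSOLUTE constant although the entries of `𝔸` are not controlled by `K₀`;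
§6 the `ℂ³` packaging for the cell chain: `re_transversalProj`/`im_transversalProj` (the Leray projection `Torus.transversalProj k` acts on
real and imaginary parts by `π_k`), **`abs_re_inner_symbT_proj_sub_le`**:
`|Re⟪P_k r, T_𝔸(k) P_k y⟫ − Re⟪P_{k₀} r, T_𝔸(k₀) P_{k₀} y⟫| ≤ 534·K₀·|k₀|·|k − k₀|·‖y‖‖r‖` for integer wave vectors with `4|k − k₀|² ≤ |k₀|²`
and ALL `r, y ∈ ℂ³`, and the full-modulus version **`norm_inner_symbT_proj_sub_le`** (constant `1068`).  Consumed by the T4 residual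
estimate of the V0 architecture (`Cruxes/LagrangianRenormalisationStep/Lines/onelevel-V0-exact-family.md` §4): the viscous defect
`⟨r_z, (F(ℓ+nz) − F(nz)) z_ref,z⟩` is `O(ν(hiΛ+β)·|z|·|ξ|)·|r_z|·|z_ref,z|`, to be absorbed by the dissipation of `r`.
NOT a proof of any registered stub, of K1L_D, or of anomalous dissipation; rung F-D1.A0 infrastructure.
-/

set_option linter.dupNamespace false

noncomputable section

namespace Summit.AnomalousDissipation.AnomalousDissipation.Theorems.SolenoidalFractalHomogenisation.LagrangianStep.SymbolLipschitz

open Finset Polynomial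
open scoped InnerProductSpace
open Literature.Analysis Literature.Analysis.FluidPDE Literature.Analysis.FluidPDE.Torus
open Literature.Analysis.FunctionSpaces.Torus (freqNormSq)

/-! ## §4 The derivative of the projected symbol at a base point -/

/-- **The derivative of the projected symbol along a line at its base point**: for `|k| > 0` there is `D` with
`HasDerivAt (s ↦ G(k+sδ;p,q)/|k+sδ|⁴) D 0` and `|D| ≤ 356·K₀·|k|·|δ|·|p||q|`. [folklore] -/
theorem hasDerivAt_ratio_zero {𝔸 : Visc4 (Fin 3)} {K₀ : ℝ} (hK₀ : 0 ≤ K₀)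
    (hK : ∀ k p q : Fin 3 → ℝ, ∑ i, p i * k i = 0 → ∑ i, q i * k i = 0 →
      |bsymb 𝔸 k p q| ≤ K₀ * (∑ a, k a ^ 2) * (Real.sqrt (∑ i, p i ^ 2) * Real.sqrt (∑ i, q i ^ 2)))
    (k δ p q : Fin 3 → ℝ) (hk : 0 < nsqR k) (hδ : 0 < nsqR δ) :
    ∃ D : ℝ, HasDerivAt (fun s : ℝ => GR 𝔸 (k + s • δ) p q / nsqR (k + s • δ) ^ 2) D 0 ∧
      |D| ≤ 356 * K₀ * Real.sqrt (nsqR k) * Real.sqrt (nsqR δ) * (Real.sqrt (∑ i, p i ^ 2) * Real.sqrt (∑ i, q i ^ 2)) := by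
  set a := Real.sqrt (nsqR k) with ha
  set b := Real.sqrt (nsqR δ) with hb
  have ha0 : 0 < a := Real.sqrt_pos.2 hk
  have hb0 : 0 < b := Real.sqrt_pos.2 hδ
  have ha2 : a ^ 2 = nsqR k := Real.sq_sqrt hk.le
  set PQ := Real.sqrt (∑ i, p i ^ 2) * Real.sqrt (∑ i, q i ^ 2) with hPQ
  have hPQ0 : 0 ≤ PQ := by positivity
  -- the numerator and its derivative
  set N' := (GX 𝔸 k δ p q).derivative.eval 0 with hN'
  have hN : HasDerivAt (fun s : ℝ => GR 𝔸 (k + s • δ) p q) N' 0 := by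
    have h := (GX 𝔸 k δ p q).hasDerivAt 0
    simp only [eval_GX] at h
    exact h
  -- the denominator and its derivative
  have hd : HasDerivAt (fun s : ℝ => nsqR (k + s • δ)) (2 * dotR k δ) 0 := by
    have hfun : (fun s : ℝ => nsqR (k + s • δ)) = fun s : ℝ => nsqR k + 2 * s * dotR k δ + s ^ 2 * nsqR δ :=
      funext (nsqR_add_smul k δ)
    rw [hfun]
    have h1 : HasDerivAt (fun s : ℝ => 2 * s * dotR k δ) (2 * 1 * dotR k δ) 0 :=
      ((hasDerivAt_id (0:ℝ)).const_mul 2).mul_const _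
    have h2 : HasDerivAt (fun s : ℝ => s ^ 2 * nsqR δ) (((2:ℕ) : ℝ) * (0:ℝ) ^ (2 - 1) * nsqR δ) 0 :=
      (hasDerivAt_pow 2 (0:ℝ)).mul_const _
    refine (((hasDerivAt_const (0:ℝ) (nsqR k)).fun_add h1).fun_add h2).congr_deriv ?_
    norm_num
  have hd2 : HasDerivAt (fun s : ℝ => nsqR (k + s • δ) ^ 2) (((2:ℕ) : ℝ) * nsqR (k + (0:ℝ) • δ) ^ (2 - 1) * (2 * dotR k δ)) 0 :=
    hd.fun_pow 2
  have hk0 : nsqR (k + (0:ℝ) • δ) = nsqR k := by simp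
  have hne : nsqR (k + (0:ℝ) • δ) ^ 2 ≠ 0 := by rw [hk0]; exact pow_ne_zero 2 hk.ne'
  have hf := hN.fun_div hd2 hne
  refine ⟨_, hf, ?_⟩
  -- bound
  simp only [zero_smul, add_zero] at hf ⊢
  have hN0 : |GR 𝔸 k p q| ≤ K₀ * nsqR k ^ 3 * PQ := abs_GR_le hK₀ hK k p q
  have hN1 : |N'| * a ≤ 352 * K₀ * nsqR k ^ 3 * b * PQ := abs_derivative_GX_mul_le hK₀ hK k δ p q hk hδ
  have hdot : |dotR k δ| ≤ a * b := abs_dotR_le k δ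
  have hk4 : (0:ℝ) < (nsqR k ^ 2) ^ 2 := by positivity
  rw [abs_div, abs_of_pos hk4, div_le_iff₀ hk4]
  have hnum : |N' * nsqR k ^ 2 - GR 𝔸 k p q * ((2:ℕ) * nsqR k ^ (2 - 1) * (2 * dotR k δ))|
      ≤ |N'| * nsqR k ^ 2 + 4 * |GR 𝔸 k p q| * nsqR k * |dotR k δ| := by
    calc |N' * nsqR k ^ 2 - GR 𝔸 k p q * ((2:ℕ) * nsqR k ^ (2 - 1) * (2 * dotR k δ))|
        ≤ |N' * nsqR k ^ 2| + |GR 𝔸 k p q * ((2:ℕ) * nsqR k ^ (2 - 1) * (2 * dotR k δ))| := abs_sub _ _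
      _ = |N'| * nsqR k ^ 2 + 4 * |GR 𝔸 k p q| * nsqR k * |dotR k δ| := by
          simp only [abs_mul, Nat.cast_ofNat, pow_one, Nat.add_one_sub_one, abs_pow, abs_of_nonneg (nsqR_nonneg k),
            abs_two]
          ring
  refine le_trans hnum ?_
  -- everything in terms of `a`: `nsqR k = a²`
  rw [← ha2]
  rw [← ha2] at hN0 hN1
  have t1 : |N'| * (a ^ 2) ^ 2 ≤ 352 * K₀ * a ^ 9 * b * PQ := by
    have h := mul_le_mul_of_nonneg_right hN1 (by positivity : (0:ℝ) ≤ a ^ 3)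
    calc |N'| * (a ^ 2) ^ 2 = |N'| * a * a ^ 3 := by ring
      _ ≤ 352 * K₀ * (a ^ 2) ^ 3 * b * PQ * a ^ 3 := h
      _ = 352 * K₀ * a ^ 9 * b * PQ := by ring
  have t2 : 4 * |GR 𝔸 k p q| * a ^ 2 * |dotR k δ| ≤ 4 * (K₀ * (a ^ 2) ^ 3 * PQ) * a ^ 2 * (a * b) := by
    gcongr
  have t3 : 4 * (K₀ * (a ^ 2) ^ 3 * PQ) * a ^ 2 * (a * b) = 4 * K₀ * a ^ 9 * b * PQ := by ring
  have t4 : 356 * K₀ * a * b * PQ * ((a ^ 2) ^ 2) ^ 2 = 352 * K₀ * a ^ 9 * b * PQ + 4 * K₀ * a ^ 9 * b * PQ := by ring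
  rw [t4]; rw [t3] at t2
  exact add_le_add t1 t2

/-! ## §5 The real theorem: the Leray-projected symbol is direction-Lipschitz with a transverse constant -/

/-- The (normalised) Leray projection of a real vector, `π_k p = p − (p·k/|k|²) k`. [cite: Temam1984, Ch. III §1.1] -/
def lerayR (k p : Fin 3 → ℝ) : Fin 3 → ℝ := fun i => p i - dotR k p / nsqR k * k i

/-- `π_k p = |k|⁻²·(|k|²π_k p)` for `k ≠ 0`. [cite: Temam1984, Ch. III §1.1] -/
theorem lerayR_eq_smul_projR {k : Fin 3 → ℝ} (hk : nsqR k ≠ 0) (p : Fin 3 → ℝ) :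
    lerayR k p = (nsqR k)⁻¹ • projR k p := by
  funext i
  simp only [lerayR, projR, Pi.smul_apply, smul_eq_mul]
  field_simp

/-- The projected symbol as the ratio `G/|k|⁴`. [cite: Frisch1995Turbulence, §9.6.3 eq. (9.57) p. 233] -/
theorem bsymb_lerayR_eq {𝔸 : Visc4 (Fin 3)} {k : Fin 3 → ℝ} (hk : nsqR k ≠ 0) (p q : Fin 3 → ℝ) :
    bsymb 𝔸 k (lerayR k p) (lerayR k q) = GR 𝔸 k p q / nsqR k ^ 2 := by
  rw [lerayR_eq_smul_projR hk, lerayR_eq_smul_projR hk, bsymb_smul_left, bsymb_smul_right, GR, bsymbR_eq_bsymb]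
  field_simp

/-- **DIRECTION-LIPSCHITZ CONTINUITY OF THE LERAY-PROJECTED SYMBOL FROM TRANSVERSE DATA.**  If the bilinear symbol of `𝔸`
is bounded by `K₀|k|²|p||q|` on TRANSVERSE pairs only (e.g. `K₀ = hi + β/2` from `NearIso 𝔸 lo hi`, `0 ≤ lo`, `OddSmall 𝔸 β`,
`…ThreeMode.abs_bsymb_le`), then for `|δ| ≤ |k|/2` and ALL `p, q`:
`|β_𝔸(k+δ; π_{k+δ}p, π_{k+δ}q) − β_𝔸(k; π_k p, π_k q)| ≤ 534·K₀·|k|·|δ|·|p|·|q|` — an ABSOLUTE constant although the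
entries of `𝔸` are not controlled by `K₀` (Bernstein–Markov along the line `k + sδ` + mean value inequality). [folklore] -/
theorem abs_bsymb_lerayR_sub_le {𝔸 : Visc4 (Fin 3)} {K₀ : ℝ} (hK₀ : 0 ≤ K₀)
    (hK : ∀ k p q : Fin 3 → ℝ, ∑ i, p i * k i = 0 → ∑ i, q i * k i = 0 →
      |bsymb 𝔸 k p q| ≤ K₀ * (∑ a, k a ^ 2) * (Real.sqrt (∑ i, p i ^ 2) * Real.sqrt (∑ i, q i ^ 2)))
    (k δ p q : Fin 3 → ℝ) (hk : 0 < nsqR k) (hδk : 4 * nsqR δ ≤ nsqR k) :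
    |bsymb 𝔸 (k + δ) (lerayR (k + δ) p) (lerayR (k + δ) q) - bsymb 𝔸 k (lerayR k p) (lerayR k q)|
      ≤ 534 * K₀ * Real.sqrt (nsqR k) * Real.sqrt (nsqR δ) * (Real.sqrt (∑ i, p i ^ 2) * Real.sqrt (∑ i, q i ^ 2)) := by
  set a := Real.sqrt (nsqR k) with ha
  set b := Real.sqrt (nsqR δ) with hb
  set PQ := Real.sqrt (∑ i, p i ^ 2) * Real.sqrt (∑ i, q i ^ 2) with hPQ
  have ha0 : 0 < a := Real.sqrt_pos.2 hk
  have hb0 : 0 ≤ b := Real.sqrt_nonneg _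
  have hPQ0 : 0 ≤ PQ := by positivity
  have hba : 2 * b ≤ a := by
    have : Real.sqrt (4 * nsqR δ) ≤ a := Real.sqrt_le_sqrt hδk
    rwa [Real.sqrt_mul (by norm_num), show Real.sqrt 4 = 2 by
      rw [show (4:ℝ) = 2 ^ 2 by norm_num, Real.sqrt_sq (by norm_num)]] at this
  rcases (nsqR_nonneg δ).eq_or_lt with hδ0 | hδpos
  · -- `δ = 0`: nothing moves
    have hδz : δ = 0 := by
      funext a'
      have : ∑ a, δ a ^ 2 = 0 := hδ0.symm
      exact pow_eq_zero_iff (n := 2) (by norm_num) |>.1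
        ((Finset.sum_eq_zero_iff_of_nonneg fun a _ => sq_nonneg (δ a)).1 this a' (Finset.mem_univ _))
    simp [hδz]
    positivity
  -- the ratio along the segment
  set f : ℝ → ℝ := fun s : ℝ => GR 𝔸 (k + s • δ) p q / nsqR (k + s • δ) ^ 2 with hf
  -- positivity and size of `|k_s|` on `[0,1]`
  have hseg : ∀ s ∈ Set.Icc (0:ℝ) 1, a / 2 ≤ Real.sqrt (nsqR (k + s • δ)) ∧ Real.sqrt (nsqR (k + s • δ)) ≤ 3 / 2 * a := by
    intro s hs
    have hs1 : |s| ≤ 1 := abs_le.2 ⟨by linarith [hs.1], hs.2⟩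
    constructor
    · have h1 := sq_sub_le_nsqR_add_smul k δ s
      have h2 : a / 2 ≤ a - |s| * b := by nlinarith [mul_le_mul hs1 le_rfl hb0 zero_le_one]
      calc a / 2 = Real.sqrt ((a / 2) ^ 2) := (Real.sqrt_sq (by positivity)).symm
        _ ≤ Real.sqrt ((a - |s| * b) ^ 2) := Real.sqrt_le_sqrt (by gcongr)
        _ ≤ Real.sqrt (nsqR (k + s • δ)) := Real.sqrt_le_sqrt h1
    · have h1 := nsqR_add_smul_le k δ s
      calc Real.sqrt (nsqR (k + s • δ)) ≤ Real.sqrt ((a + |s| * b) ^ 2) := Real.sqrt_le_sqrt h1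
        _ = a + |s| * b := Real.sqrt_sq (by positivity)
        _ ≤ 3 / 2 * a := by nlinarith [mul_le_mul hs1 le_rfl hb0 zero_le_one]
  -- derivative at every point of the segment, by re-basing at `k_s`
  have hderiv : ∀ s ∈ Set.Icc (0:ℝ) 1, ∃ D : ℝ, HasDerivAt f D s ∧ |D| ≤ 534 * K₀ * a * b * PQ := by
    intro s hs
    obtain ⟨hlo, hhi⟩ := hseg s hs
    have hks : 0 < nsqR (k + s • δ) := by
      have : 0 < Real.sqrt (nsqR (k + s • δ)) := lt_of_lt_of_le (by positivity) hlo
      exact Real.sqrt_pos.1 this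
    obtain ⟨D, hD, hDle⟩ := hasDerivAt_ratio_zero hK₀ hK (k + s • δ) δ p q hks hδpos
    refine ⟨D, ?_, ?_⟩
    · have hshift : HasDerivAt (fun t : ℝ => GR 𝔸 (k + s • δ + (t - s) • δ) p q / nsqR (k + s • δ + (t - s) • δ) ^ 2) D s := by
        have := HasDerivAt.comp_sub_const s s (f := fun σ : ℝ => GR 𝔸 (k + s • δ + σ • δ) p q / nsqR (k + s • δ + σ • δ) ^ 2)
          (by rw [sub_self]; exact hD)
        exact this
      have hfun : (fun t : ℝ => GR 𝔸 (k + s • δ + (t - s) • δ) p q / nsqR (k + s • δ + (t - s) • δ) ^ 2) = f := by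
        funext t
        have : k + s • δ + (t - s) • δ = k + t • δ := by
          funext i; simp only [Pi.add_apply, Pi.smul_apply, smul_eq_mul]; ring
        simp only [hf, this]
      rwa [hfun] at hshift
    · calc |D| ≤ 356 * K₀ * Real.sqrt (nsqR (k + s • δ)) * Real.sqrt (nsqR δ) * PQ := hDle
        _ ≤ 356 * K₀ * (3 / 2 * a) * b * PQ := by gcongr
        _ = 534 * K₀ * a * b * PQ := by ring
  choose! D hD using hderiv
  have hmvt := norm_image_sub_le_of_norm_deriv_le_segment' (f := f) (f' := D) (a := 0) (b := 1) (C := 534 * K₀ * a * b * PQ)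
    (fun s hs => (hD s hs).1.hasDerivWithinAt) (fun s hs => by
      rw [Real.norm_eq_abs]; exact (hD s (Set.Ico_subset_Icc_self hs)).2) 1 (by norm_num)
  rw [Real.norm_eq_abs, sub_zero, mul_one] at hmvt
  -- identify the end points
  have hk1 : nsqR (k + δ) ≠ 0 := by
    have := (hseg 1 (by norm_num)).1
    rw [one_smul] at this
    have : 0 < Real.sqrt (nsqR (k + δ)) := lt_of_lt_of_le (by positivity) this
    exact (Real.sqrt_pos.1 this).ne'
  have e1 : f 1 = bsymb 𝔸 (k + δ) (lerayR (k + δ) p) (lerayR (k + δ) q) := by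
    rw [hf]; simp only [one_smul]; rw [bsymb_lerayR_eq hk1]
  have e0 : f 0 = bsymb 𝔸 k (lerayR k p) (lerayR k q) := by
    rw [hf]; simp only [zero_smul, add_zero]; rw [bsymb_lerayR_eq hk.ne']
  rw [e1, e0] at hmvt
  exact hmvt

/-! ## §6 Complex packaging: the Leray-projected symbol matrix on `ℂ³` -/

/-- The real cast of an integer wave vector. [folklore] -/
def castZ (k : Fin 3 → ℤ) : Fin 3 → ℝ := fun a => (k a : ℝ)

/-- `|castZ k|² = freqNormSq k`. [folklore] -/
theorem nsqR_castZ (k : Fin 3 → ℤ) : nsqR (castZ k) = freqNormSq k := rfl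

/-- `castZ` is additive. [folklore] -/
theorem castZ_sub (k k₀ : Fin 3 → ℤ) : castZ k₀ + castZ (k - k₀) = castZ k := by
  funext a; simp [castZ]

/-- `Re(−i·w) = Im w`. [folklore] -/
theorem re_neg_I_mul (w : ℂ) : (-Complex.I * w).re = w.im := by simp

/-- **The Leray projection acts on real parts by `π_k`.** [cite: Temam1984, Ch. III §1.1] -/
theorem re_transversalProj (k : Fin 3 → ℤ) (z : EuclideanSpace ℂ (Fin 3)) (i : Fin 3) :
    (transversalProj k z i).re = lerayR (castZ k) (fun j => (z j).re) i := by
  have hc : (((freqNormSq k : ℝ) : ℂ)⁻¹ * kdot k z).re = (∑ j, (z j).re * (k j : ℝ)) / freqNormSq k := by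
    rw [kdot_apply, ← Complex.ofReal_inv, Complex.re_ofReal_mul, Complex.re_sum, div_eq_inv_mul]
    congr 1
    refine Finset.sum_congr rfl fun j _ => ?_
    rw [← Complex.ofReal_intCast, Complex.re_ofReal_mul, mul_comm]
  rw [transversalProj_apply, PiLp.sub_apply, PiLp.smul_apply, waveVecC_apply, smul_eq_mul, Complex.sub_re,
    ← Complex.ofReal_intCast, Complex.re_mul_ofReal, hc]
  simp only [lerayR, dotR, nsqR_castZ, castZ]

/-- **The Leray projection acts on imaginary parts by `π_k`.** [cite: Temam1984, Ch. III §1.1] -/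
theorem im_transversalProj (k : Fin 3 → ℤ) (z : EuclideanSpace ℂ (Fin 3)) (i : Fin 3) :
    (transversalProj k z i).im = lerayR (castZ k) (fun j => (z j).im) i := by
  have h := re_transversalProj k ((-Complex.I) • z) i
  simp only [map_smul, PiLp.smul_apply, smul_eq_mul, re_neg_I_mul] at h
  exact h

/-- **DIRECTION-LIPSCHITZ CONTINUITY OF `Re⟪P_k r, T_𝔸(k) P_k y⟫` FROM TRANSVERSE DATA** (integer wave vectors `k`, `k₀ ≠ 0` with
`4|k − k₀|² ≤ |k₀|²`; ALL `r, y ∈ ℂ³`; `K₀` any transverse bound of the bilinear symbol):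
`|Re⟪P_k r, T(k) P_k y⟫ − Re⟪P_{k₀} r, T(k₀) P_{k₀} y⟫| ≤ 534·K₀·|k₀|·|k − k₀|·‖y‖·‖r‖`. [folklore] -/
theorem abs_re_inner_symbT_proj_sub_le {𝔸 : Visc4 (Fin 3)} {K₀ : ℝ} (hK₀ : 0 ≤ K₀)
    (hK : ∀ k p q : Fin 3 → ℝ, ∑ i, p i * k i = 0 → ∑ i, q i * k i = 0 →
      |bsymb 𝔸 k p q| ≤ K₀ * (∑ a, k a ^ 2) * (Real.sqrt (∑ i, p i ^ 2) * Real.sqrt (∑ i, q i ^ 2)))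
    (k k₀ : Fin 3 → ℤ) (hk₀ : k₀ ≠ 0) (hclose : 4 * freqNormSq (k - k₀) ≤ freqNormSq k₀) (r y : EuclideanSpace ℂ (Fin 3)) :
    |(⟪transversalProj k r, symbT 𝔸 k (transversalProj k y)⟫_ℂ).re
        - (⟪transversalProj k₀ r, symbT 𝔸 k₀ (transversalProj k₀ y)⟫_ℂ).re|
      ≤ 534 * K₀ * Real.sqrt (freqNormSq k₀) * Real.sqrt (freqNormSq (k - k₀)) * (‖y‖ * ‖r‖) := by
  have hk₀' : 0 < nsqR (castZ k₀) := by
    rw [nsqR_castZ]; exact freqNormSq_pos_of_ne_zero' hk₀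
  have hclose' : 4 * nsqR (castZ (k - k₀)) ≤ nsqR (castZ k₀) := by rwa [nsqR_castZ, nsqR_castZ]
  -- real and imaginary parts
  set yr : Fin 3 → ℝ := fun j => (y j).re
  set yi : Fin 3 → ℝ := fun j => (y j).im
  set rr : Fin 3 → ℝ := fun j => (r j).re
  set ri : Fin 3 → ℝ := fun j => (r j).im
  have hre : ∀ (κ : Fin 3 → ℤ), (⟪transversalProj κ r, symbT 𝔸 κ (transversalProj κ y)⟫_ℂ).re
      = bsymb 𝔸 (castZ κ) (lerayR (castZ κ) yr) (lerayR (castZ κ) rr) + bsymb 𝔸 (castZ κ) (lerayR (castZ κ) yi) (lerayR (castZ κ) ri) := by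
    intro κ
    rw [ThreeMode.re_inner_symbT_bilin]
    have e1 : (fun i => (transversalProj κ y i).re) = lerayR (castZ κ) yr := funext (re_transversalProj κ y)
    have e2 : (fun j => (transversalProj κ r j).re) = lerayR (castZ κ) rr := funext (re_transversalProj κ r)
    have e3 : (fun i => (transversalProj κ y i).im) = lerayR (castZ κ) yi := funext (im_transversalProj κ y)
    have e4 : (fun j => (transversalProj κ r j).im) = lerayR (castZ κ) ri := funext (im_transversalProj κ r)
    rw [e1, e2, e3, e4]
    rfl
  rw [hre k, hre k₀]
  have h1 := abs_bsymb_lerayR_sub_le hK₀ hK (castZ k₀) (castZ (k - k₀)) yr rr hk₀' hclose'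
  have h2 := abs_bsymb_lerayR_sub_le hK₀ hK (castZ k₀) (castZ (k - k₀)) yi ri hk₀' hclose'
  rw [castZ_sub] at h1 h2
  rw [nsqR_castZ, nsqR_castZ] at h1 h2
  have hsum := ThreeMode.sqrt_mul_add_sqrt_mul_le (a := ∑ i, yr i ^ 2) (b := ∑ i, yi i ^ 2) (c := ∑ i, rr i ^ 2) (d := ∑ i, ri i ^ 2)
    (by positivity) (by positivity) (by positivity) (by positivity)
  have hy : Real.sqrt (∑ i, yr i ^ 2 + ∑ i, yi i ^ 2) = ‖y‖ := by
    rw [← ThreeMode.norm_sq_re_im y, Real.sqrt_sq (norm_nonneg _)]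
  have hr : Real.sqrt (∑ i, rr i ^ 2 + ∑ i, ri i ^ 2) = ‖r‖ := by
    rw [← ThreeMode.norm_sq_re_im r, Real.sqrt_sq (norm_nonneg _)]
  rw [hy, hr] at hsum
  have hC : 0 ≤ 534 * K₀ * Real.sqrt (freqNormSq k₀) * Real.sqrt (freqNormSq (k - k₀)) := by positivity
  calc |bsymb 𝔸 (castZ k) (lerayR (castZ k) yr) (lerayR (castZ k) rr) + bsymb 𝔸 (castZ k) (lerayR (castZ k) yi) (lerayR (castZ k) ri)
        - (bsymb 𝔸 (castZ k₀) (lerayR (castZ k₀) yr) (lerayR (castZ k₀) rr)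
          + bsymb 𝔸 (castZ k₀) (lerayR (castZ k₀) yi) (lerayR (castZ k₀) ri))|
      = |(bsymb 𝔸 (castZ k) (lerayR (castZ k) yr) (lerayR (castZ k) rr) - bsymb 𝔸 (castZ k₀) (lerayR (castZ k₀) yr) (lerayR (castZ k₀) rr))
        + (bsymb 𝔸 (castZ k) (lerayR (castZ k) yi) (lerayR (castZ k) ri) - bsymb 𝔸 (castZ k₀) (lerayR (castZ k₀) yi) (lerayR (castZ k₀) ri))| := by
        ring_nf
    _ ≤ |bsymb 𝔸 (castZ k) (lerayR (castZ k) yr) (lerayR (castZ k) rr) - bsymb 𝔸 (castZ k₀) (lerayR (castZ k₀) yr) (lerayR (castZ k₀) rr)|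
        + |bsymb 𝔸 (castZ k) (lerayR (castZ k) yi) (lerayR (castZ k) ri) - bsymb 𝔸 (castZ k₀) (lerayR (castZ k₀) yi) (lerayR (castZ k₀) ri)| :=
        abs_add_le _ _
    _ ≤ 534 * K₀ * Real.sqrt (freqNormSq k₀) * Real.sqrt (freqNormSq (k - k₀)) * (Real.sqrt (∑ i, yr i ^ 2) * Real.sqrt (∑ i, rr i ^ 2))
        + 534 * K₀ * Real.sqrt (freqNormSq k₀) * Real.sqrt (freqNormSq (k - k₀)) * (Real.sqrt (∑ i, yi i ^ 2) * Real.sqrt (∑ i, ri i ^ 2)) :=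
        add_le_add h1 h2
    _ = 534 * K₀ * Real.sqrt (freqNormSq k₀) * Real.sqrt (freqNormSq (k - k₀))
        * (Real.sqrt (∑ i, yr i ^ 2) * Real.sqrt (∑ i, rr i ^ 2) + Real.sqrt (∑ i, yi i ^ 2) * Real.sqrt (∑ i, ri i ^ 2)) := by ring
    _ ≤ 534 * K₀ * Real.sqrt (freqNormSq k₀) * Real.sqrt (freqNormSq (k - k₀)) * (‖y‖ * ‖r‖) :=
        mul_le_mul_of_nonneg_left hsum hC

/-- **Full-modulus version**: `‖⟪P_k r, T(k) P_k y⟫ − ⟪P_{k₀} r, T(k₀) P_{k₀} y⟫‖ ≤ 1068·K₀·|k₀|·|k − k₀|·‖y‖·‖r‖` (the imaginary part is the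
real part after `y ↦ (−i)•y`). [folklore] -/
theorem norm_inner_symbT_proj_sub_le {𝔸 : Visc4 (Fin 3)} {K₀ : ℝ} (hK₀ : 0 ≤ K₀)
    (hK : ∀ k p q : Fin 3 → ℝ, ∑ i, p i * k i = 0 → ∑ i, q i * k i = 0 →
      |bsymb 𝔸 k p q| ≤ K₀ * (∑ a, k a ^ 2) * (Real.sqrt (∑ i, p i ^ 2) * Real.sqrt (∑ i, q i ^ 2)))
    (k k₀ : Fin 3 → ℤ) (hk₀ : k₀ ≠ 0) (hclose : 4 * freqNormSq (k - k₀) ≤ freqNormSq k₀) (r y : EuclideanSpace ℂ (Fin 3)) :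
    ‖⟪transversalProj k r, symbT 𝔸 k (transversalProj k y)⟫_ℂ - ⟪transversalProj k₀ r, symbT 𝔸 k₀ (transversalProj k₀ y)⟫_ℂ‖
      ≤ 1068 * K₀ * Real.sqrt (freqNormSq k₀) * Real.sqrt (freqNormSq (k - k₀)) * (‖y‖ * ‖r‖) := by
  set Z := ⟪transversalProj k r, symbT 𝔸 k (transversalProj k y)⟫_ℂ - ⟪transversalProj k₀ r, symbT 𝔸 k₀ (transversalProj k₀ y)⟫_ℂ with hZ
  have hre : |Z.re| ≤ 534 * K₀ * Real.sqrt (freqNormSq k₀) * Real.sqrt (freqNormSq (k - k₀)) * (‖y‖ * ‖r‖) := by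
    rw [hZ, Complex.sub_re]; exact abs_re_inner_symbT_proj_sub_le hK₀ hK k k₀ hk₀ hclose r y
  have him : |Z.im| ≤ 534 * K₀ * Real.sqrt (freqNormSq k₀) * Real.sqrt (freqNormSq (k - k₀)) * (‖y‖ * ‖r‖) := by
    have h := abs_re_inner_symbT_proj_sub_le hK₀ hK k k₀ hk₀ hclose r ((-Complex.I) • y)
    rw [map_smul, map_smul, symbT_smul, symbT_smul, inner_smul_right, inner_smul_right, re_neg_I_mul, re_neg_I_mul, norm_smul,
      norm_neg, Complex.norm_I, one_mul] at h
    rw [hZ, Complex.sub_im]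
    exact h
  calc ‖Z‖ ≤ |Z.re| + |Z.im| := Complex.norm_le_abs_re_add_abs_im Z
    _ ≤ _ := by linarith [hre, him]


end Summit.AnomalousDissipation.AnomalousDissipation.Theorems.SolenoidalFractalHomogenisation.LagrangianStep.SymbolLipschitz

end
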